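/-
Copyright (c) 2026 the pub-hodgecm-mathlib formalisation cell (harness21).  Prover seat hodgecm-mathlib-K2E5-p12 (g2), HCML Track B «K2-LIT», h413 =
`stmt-HodgeConjecture-24833`, line `K2_E3_EllipticInputs`, unit U3b, sub-line (ii♭-H) «RANK-ONE CAYLEY ROAD», letter (Ψ-package₂¹) — brick (β): the product
smoothness clause (S_H) of the rank-one Cayley scaling.  2026-09-04.
-/
import Summits.HodgeConjecture.HodgeConjecture.Theorems.K2E3CayleyScalingRankOnePackageHolds   -- ★ (SC₂) chain (this seat) + ★ p855742∕p855813 (rank-one ball: `ball_isClopen`, `continuous_restrict_cayleyScaling`, `cayleyScaling_mem_of_ball`, `cayleyScaling_left_inv`)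
import HarnessLib

/-!
# h413 ∕ K2-LIT, line `K2_E3_EllipticInputs`, unit U3b, (ii♭-H): THE PRODUCT SMOOTHNESS CLAUSE (S_H) OF THE RANK-ONE CAYLEY SCALING (brick (β) of the payer of
# (Ψ-package₂¹) `sig_K2E3RankOneUnipotentScalingPackageOne`)

Cell `pub/hodgecm-mathlib`, crux H413 = `stmt-HodgeConjecture-24833`; consumer K2E4-p18 (g3) (`…PackageOfIdentity`), dealers K2E3-plan ∕ K2E5-plan.  THEOREMS ONLY (no
`def`, no `instance`, no `notation`, no named-fact hypothesis, no `sorry`); lane `--supports stmt-HodgeConjecture-24833 --as helper`.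

(S_H): for `F ∈ C_c^∞(H_v)`, `H_v = U(Φ₂)_v × U(Φ₁)_v`, the pull-back `1_{U₀ × U₁}·(F ∘ (Ψ × id))` is again `C_c^∞`.  §1 is the POINT-SET core, generic in
topological spaces `X, Y`: `B ⊆ X` clopen, `B′` closed, `Ψ` continuous on `B` with `Ψ(B) ⊆ B′`, `Θ` continuous on `B′` with `Θ ∘ Ψ = id` on `B` ⇒ for `F` locally
constant with compact support on `X × Y`, `1_{B × Y}·(F ∘ (Ψ × id))` is locally constant (open pieces `B × Y`, `Bᶜ × Y`) with support inside the compact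
`(Θ × id)(tsupp F ∩ (B′ × Y))` — ★ FILE 2's (S) argument (`isLocSmooth_indicator_comp_cayleyScaling`) one factor up.  §2 reads it on the model `U(σ, J)(K)` (★
`ball_isClopen`, `continuous_restrict_cayleyScaling`, `cayleyScaling_mem_of_ball`, `cayleyScaling_left_inv`) and §3 on `G = U(Φ₂)(L⁺_v)` through
`e = localNonsplitEquiv` for `Ψ_G = e⁻¹ ∘ Ψ ∘ e`, `U₀ = e⁻¹(B)` — the letter's clause VERBATIM (`(U₀ ×ˢ univ).indicator (F ∘ fun γ => (Ψ_G γ.1, γ.2))`).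

HONEST LABEL.  HC_CM is proved only modulo the 7 printed citations (2 remaining named inputs: hLiu418 = `stmt-HodgeConjecture-24832`, h413 =
`stmt-HodgeConjecture-24833`) until rung 0 closes; count-neutral helper of the U3b (ii♭-H) sub-line.

## References
* [Rogawski1990] J. D. Rogawski, *Automorphic Representations of Unitary Groups in Three Variables* (1990), §8.1 Prop. 8.1.2 (b) p. 114; §1.6 p. 6 (`C_c^∞`).
* [PlatonovRapinchuk1994] V. Platonov, A. Rapinchuk, *Algebraic Groups and Number Theory* (1994), §3.3.
* [BernsteinZelevinsky1976] I. N. Bernstein, A. V. Zelevinsky, *Representations of GL(n, F)*, Russian Math. Surveys 31 (1976), §1.1 (l-spaces, locally constant functions).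
-/

set_option autoImplicit false
set_option linter.dupNamespace false  -- the mandated namespace repeats the single-problem summit's segment (`HodgeConjecture.HodgeConjecture`)

noncomputable section

open NumberField IsDedekindDomain Matrix Filter Topology Set
open scoped Matrix MatrixGroups
open Literature.NumberTheory.Rogawski1990 Literature.NumberTheory.Automorphic Literature.NumberTheory.Automorphic.UnitaryGroup
open Literature.NumberTheory.Weil1982.UnitaryFinTopForm
open Summit.HodgeConjecture.HodgeConjecture.Cruxes.H413.K2E3CayleyScalingRankOne Summit.HodgeConjecture.HodgeConjecture.Cruxes.H413.K2E3CayleyScalingRankOneMap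

namespace Summit.HodgeConjecture.HodgeConjecture.Cruxes.H413.K2E3CayleyScalingRankOneProductSmooth

/-! ## §1 The point-set core -/

section PointSet

variable {X Y : Type*} [TopologicalSpace X] [TopologicalSpace Y] [T2Space X] [T2Space Y] {B B' : Set X} {Ψ Θ : X → X}

/-- **`1_{B × Y}·(F ∘ (Ψ × id))` IS `C_c^∞` FOR `F ∈ C_c^∞(X × Y)`** when `B` is clopen, `B′` closed, `Ψ` continuous on `B` with `Ψ(B) ⊆ B′`, and `Θ` continuous on `B′`
inverts `Ψ` on `B`: locally constant on the open pieces `B × Y` and `Bᶜ × Y`; support inside the compact `(Θ × id)(tsupp F ∩ (B′ × Y))`.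
[cite: Rogawski1990, §8.1 Prop. 8.1.2 (b) p. 114] [cite: BernsteinZelevinsky1976, §1.1] -/
theorem isLocSmooth_indicator_prod_comp (hBo : IsOpen B) (hBc : IsClosed B) (hB'c : IsClosed B') (hΨc : ContinuousOn Ψ B) (hΘc : ContinuousOn Θ B')
    (hmem : ∀ x ∈ B, Ψ x ∈ B') (hinv : ∀ x ∈ B, Θ (Ψ x) = x) {F : X × Y → ℂ} (hF : IsLocSmooth F) :
    IsLocSmooth ((B ×ˢ (univ : Set Y)).indicator (F ∘ fun p : X × Y => (Ψ p.1, p.2))) := by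
  have hφc : ContinuousOn (fun p : X × Y => (Ψ p.1, p.2)) (B ×ˢ (univ : Set Y)) :=
    (hΨc.comp continuous_fst.continuousOn fun p hp => hp.1).prodMk continuous_snd.continuousOn
  have hOpen : IsOpen (B ×ˢ (univ : Set Y)) := hBo.prod isOpen_univ
  have hClosed : IsClosed (B ×ˢ (univ : Set Y)) := hBc.prod isClosed_univ
  refine ⟨?_, ?_⟩
  · rw [IsLocallyConstant.iff_eventually_eq]
    intro p
    by_cases hp : p ∈ B ×ˢ (univ : Set Y)
    · have hV : ∀ᶠ q in 𝓝 (Ψ p.1, p.2), F q = F (Ψ p.1, p.2) := (hF.1.isOpen_fiber (F (Ψ p.1, p.2))).mem_nhds rfl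
      have h1 : ∀ᶠ q in 𝓝[B ×ˢ (univ : Set Y)] p, F (Ψ q.1, q.2) = F (Ψ p.1, p.2) := (hφc p hp).eventually hV
      rw [hOpen.nhdsWithin_eq hp] at h1
      filter_upwards [h1, hOpen.mem_nhds hp] with q h1' h2'
      rw [indicator_of_mem h2', indicator_of_mem hp]
      exact h1'
    · filter_upwards [hClosed.isOpen_compl.mem_nhds hp] with q h
      rw [indicator_of_notMem h, indicator_of_notMem hp]
  · have hΘc' : ContinuousOn (fun q : X × Y => (Θ q.1, q.2)) (tsupport F ∩ B' ×ˢ (univ : Set Y)) :=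
      ((hΘc.comp continuous_fst.continuousOn fun q hq => hq.2.1).prodMk continuous_snd.continuousOn)
    have hK : IsCompact ((fun q : X × Y => (Θ q.1, q.2)) '' (tsupport F ∩ B' ×ˢ (univ : Set Y))) :=
      (hF.2.inter_right (hB'c.prod isClosed_univ)).image_of_continuousOn hΘc'
    refine HasCompactSupport.intro hK fun p hp => ?_
    by_contra hne
    have hpB : p ∈ B ×ˢ (univ : Set Y) := by
      by_contra h
      exact hne (indicator_of_notMem h _)
    rw [indicator_of_mem hpB] at hne
    refine hp ⟨(Ψ p.1, p.2), ⟨subset_tsupport _ hne, hmem p.1 hpB.1, mem_univ _⟩, ?_⟩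
    simp only [hinv p.1 hpB.1]

end PointSet

/-! ## §2 The model `U(σ, J)(K)` -/

section Model

variable {K : Type*} [NormedField K] [IsUltrametricDist K] (σ : K →+* K) (J : Matrix (Fin 2) (Fin 2) K) {ρ : ℝ} {s : K}
  {B : Set ↥(unitaryGroupOfForm σ J)}
  (hB : ∀ u : ↥(unitaryGroupOfForm σ J), u ∈ B ↔
    IsUnit (((u : GL (Fin 2) K) : Matrix (Fin 2) (Fin 2) K) + 1).det ∧
    ‖((((u : GL (Fin 2) K) : Matrix (Fin 2) (Fin 2) K) - 1) * (((u : GL (Fin 2) K) : Matrix (Fin 2) (Fin 2) K) + 1)⁻¹).trace‖ ≤ ρ ∧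
    ‖((((u : GL (Fin 2) K) : Matrix (Fin 2) (Fin 2) K) - 1) * (((u : GL (Fin 2) K) : Matrix (Fin 2) (Fin 2) K) + 1)⁻¹).det‖ ≤ ρ ^ 2)
  {Ψ : ↥(unitaryGroupOfForm σ J) → ↥(unitaryGroupOfForm σ J)}
  (hΨ : ∀ u ∈ B,
    (((Ψ u : ↥(unitaryGroupOfForm σ J)) : GL (Fin 2) K) : Matrix (Fin 2) (Fin 2) K) =
        cayley (s • ((((u : GL (Fin 2) K) : Matrix (Fin 2) (Fin 2) K) - 1) * (((u : GL (Fin 2) K) : Matrix (Fin 2) (Fin 2) K) + 1)⁻¹)) ∧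
    ((((Ψ u : ↥(unitaryGroupOfForm σ J)) : GL (Fin 2) K)⁻¹ : GL (Fin 2) K) : Matrix (Fin 2) (Fin 2) K) =
        cayley (-(s • ((((u : GL (Fin 2) K) : Matrix (Fin 2) (Fin 2) K) - 1) * (((u : GL (Fin 2) K) : Matrix (Fin 2) (Fin 2) K) + 1)⁻¹))))
  {B' : Set ↥(unitaryGroupOfForm σ J)}
  (hB' : ∀ u : ↥(unitaryGroupOfForm σ J), u ∈ B' ↔
    IsUnit (((u : GL (Fin 2) K) : Matrix (Fin 2) (Fin 2) K) + 1).det ∧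
    ‖((((u : GL (Fin 2) K) : Matrix (Fin 2) (Fin 2) K) - 1) * (((u : GL (Fin 2) K) : Matrix (Fin 2) (Fin 2) K) + 1)⁻¹).trace‖ ≤ ‖s‖ * ρ ∧
    ‖((((u : GL (Fin 2) K) : Matrix (Fin 2) (Fin 2) K) - 1) * (((u : GL (Fin 2) K) : Matrix (Fin 2) (Fin 2) K) + 1)⁻¹).det‖ ≤ (‖s‖ * ρ) ^ 2)
  {Θ : ↥(unitaryGroupOfForm σ J) → ↥(unitaryGroupOfForm σ J)}
  (hΘ : ∀ u ∈ B',
    (((Θ u : ↥(unitaryGroupOfForm σ J)) : GL (Fin 2) K) : Matrix (Fin 2) (Fin 2) K) =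
        cayley (s⁻¹ • ((((u : GL (Fin 2) K) : Matrix (Fin 2) (Fin 2) K) - 1) * (((u : GL (Fin 2) K) : Matrix (Fin 2) (Fin 2) K) + 1)⁻¹)) ∧
    ((((Θ u : ↥(unitaryGroupOfForm σ J)) : GL (Fin 2) K)⁻¹ : GL (Fin 2) K) : Matrix (Fin 2) (Fin 2) K) =
        cayley (-(s⁻¹ • ((((u : GL (Fin 2) K) : Matrix (Fin 2) (Fin 2) K) - 1) * (((u : GL (Fin 2) K) : Matrix (Fin 2) (Fin 2) K) + 1)⁻¹))))

include hB hΨ hB' hΘ in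
/-- **(S_H) ON THE MODEL**: `Y` any space, `F ∈ C_c^∞(U(σ,J)(K) × Y)` ⇒ `1_{B × Y}·(F ∘ (Ψ × id)) ∈ C_c^∞` (`2 ≠ 0`, `0 < ‖s‖ ≤ 1`, `0 < ρ < 1`; §1 with ★ `ball_isClopen`,
★ `continuous_restrict_cayleyScaling`, ★ `cayleyScaling_mem_of_ball`, ★ `cayleyScaling_left_inv`). [cite: Rogawski1990, §8.1 Prop. 8.1.2 (b) p. 114] -/
theorem isLocSmooth_indicator_prod_comp_cayleyScaling {Y : Type*} [TopologicalSpace Y] [T2Space Y] (h2 : (2 : K) ≠ 0) (hs0 : s ≠ 0) (hs1 : ‖s‖ ≤ 1)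
    (hρ0 : 0 < ρ) (hρ1 : ρ < 1) {F : ↥(unitaryGroupOfForm σ J) × Y → ℂ} (hF : IsLocSmooth F) :
    IsLocSmooth ((B ×ˢ (univ : Set Y)).indicator (F ∘ fun p : ↥(unitaryGroupOfForm σ J) × Y => (Ψ p.1, p.2))) := by
  have hsρ : ‖s‖ * ρ < 1 := lt_of_le_of_lt (mul_le_of_le_one_left hρ0.le hs1) hρ1
  have hsρ0 : 0 < ‖s‖ * ρ := mul_pos (norm_pos_iff.2 hs0) hρ0
  have hsρ' : ‖s⁻¹‖ * (‖s‖ * ρ) < 1 := by rwa [norm_inv, ← mul_assoc, inv_mul_cancel₀ (norm_ne_zero_iff.2 hs0), one_mul]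
  refine isLocSmooth_indicator_prod_comp (ball_isClopen σ J hB hρ0 hρ1 h2).2 (ball_isClopen σ J hB hρ0 hρ1 h2).1 (ball_isClopen σ J hB' hsρ0 hsρ h2).1
    (continuousOn_iff_continuous_restrict.2 (continuous_restrict_cayleyScaling σ J hB hΨ hsρ))
    (continuousOn_iff_continuous_restrict.2 (continuous_restrict_cayleyScaling σ J hB' hΘ hsρ'))
    (fun u hu => cayleyScaling_mem_of_ball σ J hB hΨ h2 hsρ le_rfl hB' hu)
    (fun u hu => cayleyScaling_left_inv σ J hB hΨ h2 hs0 hsρ le_rfl hB' (fun u' hu' => (hΘ u' hu').1) hu) hF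

end Model

/-! ## §3 On `G = U(Φ₂)(L⁺_v)`, `U(Φ₁)(L⁺_v)` the second factor -/

section CM

variable (L : Type) [Field L] [NumberField L] [IsCMField L] {v : HeightOneSpectrum (𝓞 ↥(maximalRealSubfield L))}
  (w : PlacesOver L v) (hw : IsCMField.complexConj L • w.1 = w.1) {ρ : ℝ} {s : w.1.adicCompletion L}
  {B : Set ↥(unitaryGroupOfForm (galAdicCompletionMap (L := L) (IsCMField.complexConj L) hw) (placeForm (Matrix.of fun i j : Fin 2 => if i.val + j.val + 1 = 2 then (1 : L) else 0) w.1))}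
  (hB : ∀ u : ↥(unitaryGroupOfForm (galAdicCompletionMap (L := L) (IsCMField.complexConj L) hw) (placeForm (Matrix.of fun i j : Fin 2 => if i.val + j.val + 1 = 2 then (1 : L) else 0) w.1)), u ∈ B ↔
    IsUnit ((((u : ↥(unitaryGroupOfForm (galAdicCompletionMap (L := L) (IsCMField.complexConj L) hw) (placeForm (Matrix.of fun i j : Fin 2 => if i.val + j.val + 1 = 2 then (1 : L) else 0) w.1))) : GL (Fin 2) (w.1.adicCompletion L)) : Matrix (Fin 2) (Fin 2) (w.1.adicCompletion L)) + 1).det ∧ ‖(((((u : ↥(unitaryGroupOfForm (galAdicCompletionMap (L := L) (IsCMField.complexConj L) hw) (placeForm (Matrix.of fun i j : Fin 2 => if i.val + j.val + 1 = 2 then (1 : L) else 0) w.1))) : GL (Fin 2) (w.1.adicCompletion L)) : Matrix (Fin 2) (Fin 2) (w.1.adicCompletion L)) - 1) * ((((u : ↥(unitaryGroupOfForm (galAdicCompletionMap (L := L) (IsCMField.complexConj L) hw) (placeForm (Matrix.of fun i j : Fin 2 => if i.val + j.val + 1 = 2 then (1 : L) else 0) w.1))) : GL (Fin 2) (w.1.adicCompletion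 L)) : Matrix (Fin 2) (Fin 2) (w.1.adicCompletion L)) + 1)⁻¹).trace‖ ≤ ρ ∧ ‖(((((u : ↥(unitaryGroupOfForm (galAdicCompletionMap (L := L) (IsCMField.complexConj L) hw) (placeForm (Matrix.of fun i j : Fin 2 => if i.val + j.val + 1 = 2 then (1 : L) else 0) w.1))) : GL (Fin 2) (w.1.adicCompletion L)) : Matrix (Fin 2) (Fin 2) (w.1.adicCompletion L)) - 1) * ((((u : ↥(unitaryGroupOfForm (galAdicCompletionMap (L := L) (IsCMField.complexConj L) hw) (placeForm (Matrix.of fun i j : Fin 2 => if i.val + j.val + 1 = 2 then (1 : L) else 0) w.1))) : GL (Fin 2) (w.1.adicCompletion L)) : Matrix (Fin 2) (Fin 2) (w.1.adicCompletion L)) + 1)⁻¹).det‖ ≤ ρ ^ 2)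
  {Ψ : ↥(unitaryGroupOfForm (galAdicCompletionMap (L := L) (IsCMField.complexConj L) hw) (placeForm (Matrix.of fun i j : Fin 2 => if i.val + j.val + 1 = 2 then (1 : L) else 0) w.1)) → ↥(unitaryGroupOfForm (galAdicCompletionMap (L := L) (IsCMField.complexConj L) hw) (placeForm (Matrix.of fun i j : Fin 2 => if i.val + j.val + 1 = 2 then (1 : L) else 0) w.1))}
  (hΨ : ∀ u ∈ B, (((Ψ u : ↥(unitaryGroupOfForm (galAdicCompletionMap (L := L) (IsCMField.complexConj L) hw) (placeForm (Matrix.of fun i j : Fin 2 => if i.val + j.val + 1 = 2 then (1 : L) else 0) w.1))) : GL (Fin 2) (w.1.adicCompletion L)) : Matrix (Fin 2) (Fin 2) (w.1.adicCompletion L)) = cayley (s • (((((u : ↥(unitaryGroupOfForm (galAdicCompletionMap (L := L) (IsCMField.complexConj L) hw) (placeForm (Matrix.of fun i j : Fin 2 => if i.val + j.val + 1 = 2 then (1 : L) else 0) w.1))) : GL (Fin 2) (w.1.adicCompletion L)) : Matrix (Fin 2) (Fin 2) (w.1.adicCompletion L)) - 1) * ((((u : ↥(unitaryGroupOfForm (galAdicCompletionMap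 (L := L) (IsCMField.complexConj L) hw) (placeForm (Matrix.of fun i j : Fin 2 => if i.val + j.val + 1 = 2 then (1 : L) else 0) w.1))) : GL (Fin 2) (w.1.adicCompletion L)) : Matrix (Fin 2) (Fin 2) (w.1.adicCompletion L)) + 1)⁻¹)) ∧
    (((((Ψ u : ↥(unitaryGroupOfForm (galAdicCompletionMap (L := L) (IsCMField.complexConj L) hw) (placeForm (Matrix.of fun i j : Fin 2 => if i.val + j.val + 1 = 2 then (1 : L) else 0) w.1))) : GL (Fin 2) (w.1.adicCompletion L)))⁻¹ : GL (Fin 2) (w.1.adicCompletion L)) : Matrix (Fin 2) (Fin 2) (w.1.adicCompletion L)) = cayley (-(s • (((((u : ↥(unitaryGroupOfForm (galAdicCompletionMap (L := L) (IsCMField.complexConj L) hw) (placeForm (Matrix.of fun i j : Fin 2 => if i.val + j.val + 1 = 2 then (1 : L) else 0) w.1))) : GL (Fin 2) (w.1.adicCompletion L)) : Matrix (Fin 2) (Fin 2) (w.1.adicCompletion L)) - 1) * ((((u : ↥(unitaryGroupOfForm (galAdicCompletionMap (L := L) (IsCMField.complexConj L) hw) (placeForm (Matrix.of fun i j : Fin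 2 => if i.val + j.val + 1 = 2 then (1 : L) else 0) w.1))) : GL (Fin 2) (w.1.adicCompletion L)) : Matrix (Fin 2) (Fin 2) (w.1.adicCompletion L)) + 1)⁻¹))))
  {B' : Set ↥(unitaryGroupOfForm (galAdicCompletionMap (L := L) (IsCMField.complexConj L) hw) (placeForm (Matrix.of fun i j : Fin 2 => if i.val + j.val + 1 = 2 then (1 : L) else 0) w.1))}
  (hB' : ∀ u : ↥(unitaryGroupOfForm (galAdicCompletionMap (L := L) (IsCMField.complexConj L) hw) (placeForm (Matrix.of fun i j : Fin 2 => if i.val + j.val + 1 = 2 then (1 : L) else 0) w.1)), u ∈ B' ↔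
    IsUnit ((((u : ↥(unitaryGroupOfForm (galAdicCompletionMap (L := L) (IsCMField.complexConj L) hw) (placeForm (Matrix.of fun i j : Fin 2 => if i.val + j.val + 1 = 2 then (1 : L) else 0) w.1))) : GL (Fin 2) (w.1.adicCompletion L)) : Matrix (Fin 2) (Fin 2) (w.1.adicCompletion L)) + 1).det ∧ ‖(((((u : ↥(unitaryGroupOfForm (galAdicCompletionMap (L := L) (IsCMField.complexConj L) hw) (placeForm (Matrix.of fun i j : Fin 2 => if i.val + j.val + 1 = 2 then (1 : L) else 0) w.1))) : GL (Fin 2) (w.1.adicCompletion L)) : Matrix (Fin 2) (Fin 2) (w.1.adicCompletion L)) - 1) * ((((u : ↥(unitaryGroupOfForm (galAdicCompletionMap (L := L) (IsCMField.complexConj L) hw) (placeForm (Matrix.of fun i j : Fin 2 => if i.val + j.val + 1 = 2 then (1 : L) else 0) w.1))) : GL (Fin 2) (w.1.adicCompletion L)) : Matrix (Fin 2) (Fin 2) (w.1.adicCompletion L)) + 1)⁻¹).trace‖ ≤ ‖s‖ * ρ ∧ ‖(((((u : ↥(unitaryGroupOfForm (galAdicCompletionMap (L := L) (IsCMField.complexConj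 L) hw) (placeForm (Matrix.of fun i j : Fin 2 => if i.val + j.val + 1 = 2 then (1 : L) else 0) w.1))) : GL (Fin 2) (w.1.adicCompletion L)) : Matrix (Fin 2) (Fin 2) (w.1.adicCompletion L)) - 1) * ((((u : ↥(unitaryGroupOfForm (galAdicCompletionMap (L := L) (IsCMField.complexConj L) hw) (placeForm (Matrix.of fun i j : Fin 2 => if i.val + j.val + 1 = 2 then (1 : L) else 0) w.1))) : GL (Fin 2) (w.1.adicCompletion L)) : Matrix (Fin 2) (Fin 2) (w.1.adicCompletion L)) + 1)⁻¹).det‖ ≤ (‖s‖ * ρ) ^ 2)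
  {Θ : ↥(unitaryGroupOfForm (galAdicCompletionMap (L := L) (IsCMField.complexConj L) hw) (placeForm (Matrix.of fun i j : Fin 2 => if i.val + j.val + 1 = 2 then (1 : L) else 0) w.1)) → ↥(unitaryGroupOfForm (galAdicCompletionMap (L := L) (IsCMField.complexConj L) hw) (placeForm (Matrix.of fun i j : Fin 2 => if i.val + j.val + 1 = 2 then (1 : L) else 0) w.1))}
  (hΘ : ∀ u ∈ B', (((Θ u : ↥(unitaryGroupOfForm (galAdicCompletionMap (L := L) (IsCMField.complexConj L) hw) (placeForm (Matrix.of fun i j : Fin 2 => if i.val + j.val + 1 = 2 then (1 : L) else 0) w.1))) : GL (Fin 2) (w.1.adicCompletion L)) : Matrix (Fin 2) (Fin 2) (w.1.adicCompletion L)) = cayley (s⁻¹ • (((((u : ↥(unitaryGroupOfForm (galAdicCompletionMap (L := L) (IsCMField.complexConj L) hw) (placeForm (Matrix.of fun i j : Fin 2 => if i.val + j.val + 1 = 2 then (1 : L) else 0) w.1))) : GL (Fin 2) (w.1.adicCompletion L)) : Matrix (Fin 2) (Fin 2) (w.1.adicCompletion L)) - 1) * ((((u : ↥(unitaryGroupOfForm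 (galAdicCompletionMap (L := L) (IsCMField.complexConj L) hw) (placeForm (Matrix.of fun i j : Fin 2 => if i.val + j.val + 1 = 2 then (1 : L) else 0) w.1))) : GL (Fin 2) (w.1.adicCompletion L)) : Matrix (Fin 2) (Fin 2) (w.1.adicCompletion L)) + 1)⁻¹)) ∧
    (((((Θ u : ↥(unitaryGroupOfForm (galAdicCompletionMap (L := L) (IsCMField.complexConj L) hw) (placeForm (Matrix.of fun i j : Fin 2 => if i.val + j.val + 1 = 2 then (1 : L) else 0) w.1))) : GL (Fin 2) (w.1.adicCompletion L)))⁻¹ : GL (Fin 2) (w.1.adicCompletion L)) : Matrix (Fin 2) (Fin 2) (w.1.adicCompletion L)) = cayley (-(s⁻¹ • (((((u : ↥(unitaryGroupOfForm (galAdicCompletionMap (L := L) (IsCMField.complexConj L) hw) (placeForm (Matrix.of fun i j : Fin 2 => if i.val + j.val + 1 = 2 then (1 : L) else 0) w.1))) : GL (Fin 2) (w.1.adicCompletion L)) : Matrix (Fin 2) (Fin 2) (w.1.adicCompletion L)) - 1) * ((((u : ↥(unitaryGroupOfForm (galAdicCompletionMap (L := L) (IsCMField.complexConj L) hw) (placeForm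 (Matrix.of fun i j : Fin 2 => if i.val + j.val + 1 = 2 then (1 : L) else 0) w.1))) : GL (Fin 2) (w.1.adicCompletion L)) : Matrix (Fin 2) (Fin 2) (w.1.adicCompletion L)) + 1)⁻¹))))

include hB hΨ hB' hΘ in
set_option maxHeartbeats 800000 in
/-- **(S_H)** for `Ψ_G = e⁻¹ ∘ Ψ ∘ e` on `G = U(Φ₂)(L⁺_v)`, `U₀ = e⁻¹(B)`, second factor `U(Φ₁)(L⁺_v)`: `F ∈ C_c^∞(H_v)` ⇒ `1_{U₀ × U₁}·(F ∘ (Ψ_G × id)) ∈ C_c^∞(H_v)`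
(§1 with the clopen `e⁻¹(B)`, `e⁻¹(B′)` and the continuous `e⁻¹ ∘ Ψ ∘ e`, `e⁻¹ ∘ Θ ∘ e`; `2 ≠ 0`, `0 < ‖s‖ ≤ 1`, `0 < ρ < 1`). [cite: Rogawski1990, §8.1 Prop. 8.1.2 (b) p. 114] -/
theorem isLocSmooth_indicator_prod_comp_local (h2 : (2 : w.1.adicCompletion L) ≠ 0) (hs0 : s ≠ 0) (hs1 : ‖s‖ ≤ 1) (hρ0 : 0 < ρ) (hρ1 : ρ < 1)
    {F : ((UnitaryGroup.cmDatum L 2 (Matrix.of fun i j : Fin 2 => if i.val + j.val + 1 = 2 then (1 : L) else 0)).Local v) × ((UnitaryGroup.cmDatum L 1 (Matrix.of fun i j : Fin 1 => if i.val + j.val + 1 = 1 then (1 : L) else 0)).Local v) → ℂ} (hF : IsLocSmooth F) :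
    IsLocSmooth ((({γ : (UnitaryGroup.cmDatum L 2 (Matrix.of fun i j : Fin 2 => if i.val + j.val + 1 = 2 then (1 : L) else 0)).Local v | (localNonsplitEquiv (IsCMField.complexConj L) (Matrix.of fun i j : Fin 2 => if i.val + j.val + 1 = 2 then (1 : L) else 0) (IsCMField.complexConj_ne_one L) w hw) γ ∈ B}) ×ˢ (Set.univ : Set ((UnitaryGroup.cmDatum L 1 (Matrix.of fun i j : Fin 1 => if i.val + j.val + 1 = 1 then (1 : L) else 0)).Local v))).indicator
      (F ∘ fun γ : ((UnitaryGroup.cmDatum L 2 (Matrix.of fun i j : Fin 2 => if i.val + j.val + 1 = 2 then (1 : L) else 0)).Local v) × ((UnitaryGroup.cmDatum L 1 (Matrix.of fun i j : Fin 1 => if i.val + j.val + 1 = 1 then (1 : L) else 0)).Local v) => ((localNonsplitEquiv (IsCMField.complexConj L) (Matrix.of fun i j : Fin 2 => if i.val + j.val + 1 = 2 then (1 : L) else 0) (IsCMField.complexConj_ne_one L) w hw).symm (Ψ ((localNonsplitEquiv (IsCMField.complexConj L) (Matrix.of fun i j : Fin 2 => if i.val + j.val + 1 = 2 then (1 : L)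 else 0) (IsCMField.complexConj_ne_one L) w hw) γ.1)), γ.2))) := by
  have hsρ : ‖s‖ * ρ < 1 := lt_of_le_of_lt (mul_le_of_le_one_left hρ0.le hs1) hρ1
  have hsρ0 : 0 < ‖s‖ * ρ := mul_pos (norm_pos_iff.2 hs0) hρ0
  have hsρ' : ‖s⁻¹‖ * (‖s‖ * ρ) < 1 := by rwa [norm_inv, ← mul_assoc, inv_mul_cancel₀ (norm_ne_zero_iff.2 hs0), one_mul]
  have hBcl := ball_isClopen _ _ hB hρ0 hρ1 h2
  have hB'cl := ball_isClopen _ _ hB' hsρ0 hsρ h2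
  have hΨc : ContinuousOn Ψ B := continuousOn_iff_continuous_restrict.2 (continuous_restrict_cayleyScaling _ _ hB hΨ hsρ)
  have hΘc : ContinuousOn Θ B' := continuousOn_iff_continuous_restrict.2 (continuous_restrict_cayleyScaling _ _ hB' hΘ hsρ')
  have hec : Continuous (fun γ : (UnitaryGroup.cmDatum L 2 (Matrix.of fun i j : Fin 2 => if i.val + j.val + 1 = 2 then (1 : L) else 0)).Local v => (localNonsplitEquiv (IsCMField.complexConj L) (Matrix.of fun i j : Fin 2 => if i.val + j.val + 1 = 2 then (1 : L) else 0) (IsCMField.complexConj_ne_one L) w hw) γ) := (localNonsplitEquiv (IsCMField.complexConj L) (Matrix.of fun i j : Fin 2 => if i.val + j.val + 1 = 2 then (1 : L) else 0) (IsCMField.complexConj_ne_one L) w hw).continuous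
  refine isLocSmooth_indicator_prod_comp (B := {γ : (UnitaryGroup.cmDatum L 2 (Matrix.of fun i j : Fin 2 => if i.val + j.val + 1 = 2 then (1 : L) else 0)).Local v | (localNonsplitEquiv (IsCMField.complexConj L) (Matrix.of fun i j : Fin 2 => if i.val + j.val + 1 = 2 then (1 : L) else 0) (IsCMField.complexConj_ne_one L) w hw) γ ∈ B}) (B' := {γ : (UnitaryGroup.cmDatum L 2 (Matrix.of fun i j : Fin 2 => if i.val + j.val + 1 = 2 then (1 : L) else 0)).Local v | (localNonsplitEquiv (IsCMField.complexConj L) (Matrix.of fun i j : Fin 2 => if i.val + j.val + 1 = 2 then (1 : L) else 0) (IsCMField.complexConj_ne_one L) w hw) γ ∈ B'})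
    (Ψ := fun γ : (UnitaryGroup.cmDatum L 2 (Matrix.of fun i j : Fin 2 => if i.val + j.val + 1 = 2 then (1 : L) else 0)).Local v => (localNonsplitEquiv (IsCMField.complexConj L) (Matrix.of fun i j : Fin 2 => if i.val + j.val + 1 = 2 then (1 : L) else 0) (IsCMField.complexConj_ne_one L) w hw).symm (Ψ ((localNonsplitEquiv (IsCMField.complexConj L) (Matrix.of fun i j : Fin 2 => if i.val + j.val + 1 = 2 then (1 : L) else 0) (IsCMField.complexConj_ne_one L) w hw) γ))) (Θ := fun γ : (UnitaryGroup.cmDatum L 2 (Matrix.of fun i j : Fin 2 => if i.val + j.val + 1 = 2 then (1 : L) else 0)).Local v => (localNonsplitEquiv (IsCMField.complexConj L) (Matrix.of fun i j : Fin 2 => if i.val + j.val + 1 = 2 then (1 : L) else 0) (IsCMField.complexConj_ne_one L) w hw).symm (Θ ((localNonsplitEquiv (IsCMField.complexConj L) (Matrix.of fun i j : Fin 2 => if i.val + j.val + 1 = 2 then (1 : L) else 0) (IsCMField.complexConj_ne_one L) w hw) γ)))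
    (hBcl.2.preimage hec) (hBcl.1.preimage hec) (hB'cl.1.preimage hec) ?_ ?_ ?_ ?_ hF
  · exact (localNonsplitEquiv (IsCMField.complexConj L) (Matrix.of fun i j : Fin 2 => if i.val + j.val + 1 = 2 then (1 : L) else 0) (IsCMField.complexConj_ne_one L) w hw).symm.continuous.comp_continuousOn (hΨc.comp hec.continuousOn fun γ hγ => hγ)
  · exact (localNonsplitEquiv (IsCMField.complexConj L) (Matrix.of fun i j : Fin 2 => if i.val + j.val + 1 = 2 then (1 : L) else 0) (IsCMField.complexConj_ne_one L) w hw).symm.continuous.comp_continuousOn (hΘc.comp hec.continuousOn fun γ hγ => hγ)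
  · intro γ hγ
    show (localNonsplitEquiv (IsCMField.complexConj L) (Matrix.of fun i j : Fin 2 => if i.val + j.val + 1 = 2 then (1 : L) else 0) (IsCMField.complexConj_ne_one L) w hw) ((localNonsplitEquiv (IsCMField.complexConj L) (Matrix.of fun i j : Fin 2 => if i.val + j.val + 1 = 2 then (1 : L) else 0) (IsCMField.complexConj_ne_one L) w hw).symm (Ψ ((localNonsplitEquiv (IsCMField.complexConj L) (Matrix.of fun i j : Fin 2 => if i.val + j.val + 1 = 2 then (1 : L) else 0) (IsCMField.complexConj_ne_one L) w hw) γ))) ∈ B'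
    rw [ContinuousMulEquiv.apply_symm_apply]
    exact cayleyScaling_mem_of_ball _ _ hB hΨ h2 hsρ le_rfl hB' hγ
  · intro γ hγ
    show (localNonsplitEquiv (IsCMField.complexConj L) (Matrix.of fun i j : Fin 2 => if i.val + j.val + 1 = 2 then (1 : L) else 0) (IsCMField.complexConj_ne_one L) w hw).symm (Θ ((localNonsplitEquiv (IsCMField.complexConj L) (Matrix.of fun i j : Fin 2 => if i.val + j.val + 1 = 2 then (1 : L) else 0) (IsCMField.complexConj_ne_one L) w hw) ((localNonsplitEquiv (IsCMField.complexConj L) (Matrix.of fun i j : Fin 2 => if i.val + j.val + 1 = 2 then (1 : L) else 0) (IsCMField.complexConj_ne_one L) w hw).symm (Ψ ((localNonsplitEquiv (IsCMField.complexConj L) (Matrix.of fun i j : Fin 2 => if i.val + j.val + 1 = 2 then (1 : L) else 0) (IsCMField.complexConj_ne_one L) w hw) γ))))) = γ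
    rw [ContinuousMulEquiv.apply_symm_apply, cayleyScaling_left_inv _ _ hB hΨ h2 hs0 hsρ le_rfl hB' (fun u' hu' => (hΘ u' hu').1) hγ,
      ContinuousMulEquiv.symm_apply_apply]

end CM

end Summit.HodgeConjecture.HodgeConjecture.Cruxes.H413.K2E3CayleyScalingRankOneProductSmooth

end
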